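import Literature.AlgebraicGeometry.HodgeTheory.WeilFamilyLevelStructureOfPeriodConstruction
import HarnessLib

/-!
# The CM projector of the fibre over the rational diagonal point (item stmt-HodgeConjecture-14496, route HeckePrymWeil)

Line `Sketch`, continuation lead c34 — the TRANSPORT step of the Riemann-free closure of the crux.
Deligne's period construction [U] (hypothesis `h` of
`HodgeTheory/WeilFamilyLevelStructureOfPeriodConstruction.deligne1982_weilFamily_levelStructure_of_periodConstruction`)
gives, over the rational diagonal CM point `J_R` of `X⁺(D_X)`
(`Motives.WeilDatum.exists_isWeilComplexStructure_rational`: a rational splitting `V = P ⊕ N` into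
`α`-stable subspaces, `R = α` on `P`, `-α` on `N`, `J_R = R_ℝ/√d` with `ker(J_R ∓ i) = P_ℝ, N_ℝ`), a
fibre `Y` and a `K`-linear `β : V ≃ H¹(Y(ℂ); ℚ)` carrying `V^{1,0}(J_R)` into `H^{1,0}(Y)`. This file
turns that datum into the hypotheses of the KEY LEMMA of `…CMAnchorWeilLine`
(`cm_weilClassesOf_le_algebraicClasses`):

* `cm_projector_of_periodPoint` — the projector onto `P` along `N`, transported to `H¹(Y(ℂ); ℂ)`
  along `Θ = (H¹(ℚ) ⊗ ℂ ≅ H¹(ℂ)) ∘ β_ℂ`, is an idempotent `Pr` commuting with `Ψ^*`, defined over `ℚ`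
  (rational classes to rational classes), with `im Pr ∩ V₊ ⊆ H^{0,1}(Y)` and
  `ker Pr ∩ V₊ ⊆ H^{1,0}(Y)` on `V₊ = ker(Ψ^* - i√d)` — from `WeilDatum.complexConj_cxF1_inf_eigenPlus`,
  `WeilDatum.cxF1_inf_eigenPlus` (the `P`- and `N`-parts of `V₊` are `V^{0,1} ∩ V₊`, `V^{1,0} ∩ V₊`),
  `map_cxF1_eq_hodgeOneZero` (`Θ` carries `V^{1,0}(J_R)` onto `H^{1,0}(Y)`), and the compatibility of
  `Θ` with complex conjugation (`conjClass_ofRatClass`).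

Riemann's theorem / fullness [F] is NOT used: no endomorphism of `Y` is produced, only the linear
projector on cohomology. No definition, no `sorry`, no named fact taken as hypothesis.
-/

noncomputable section

-- every declaration of this problem lives in `Summit.HodgeConjecture.HodgeConjecture.…` (summit = sub-problem)
set_option linter.dupNamespace false

open CategoryTheory AlgebraicGeometry Limits
open Literature.AlgebraicTopology.SingularHomology
open scoped TensorProduct

namespace Summit.HodgeConjecture.HodgeConjecture.Theorems.HeckePrymWeilLine

open Literature.AlgebraicGeometry Literature.AlgebraicGeometry.Motives Literature.AlgebraicGeometry.HodgeTheory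

/-- **The CM projector of the fibre over the rational diagonal point.** Let `D` be a rational Weil
datum on `V` (`dim_ℚ V = 4k`) with its rational point of `X⁺`: the splitting `V = P ⊕ N` into
`α`-stable subspaces and the operator `R` (`= α` on `P`, `-α` on `N`) whose complex structure
`J_R = R_ℝ/√d` has `ker(J_R - i) = P_ℝ`, `ker(J_R + i) = N_ℝ`
(`WeilDatum.exists_isWeilComplexStructure_rational`). Let `Y` be a complex abelian `2k`-fold with an
endomorphism `Ψ` and `β : V ≃ H¹(Y(ℂ); ℚ)` a `K`-linear isomorphism (`β ∘ α = Ψ^* ∘ β`) carrying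
`V^{1,0}(J_R)` into `H^{1,0}(Y)` — the period-surjectivity clause of Deligne's construction at `J_R`.
Then the projector `π` onto `P` along `N`, transported to `H¹(Y(ℂ); ℂ)` along
`Θ = (H¹(ℚ) ⊗ ℂ ≅ H¹(ℂ)) ∘ β_ℂ`, is an idempotent `Pr` commuting with `Ψ^*`, carrying rational
classes to rational classes, with `im Pr ∩ V₊ ⊆ H^{0,1}(Y)` and `ker Pr ∩ V₊ ⊆ H^{1,0}(Y)` on
`V₊ = ker(Ψ^* - i√d)`: on `V₊` the `P`-part is `V^{0,1}(J_R) ∩ V₊` and the `N`-part is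
`V^{1,0}(J_R) ∩ V₊` (`WeilDatum.complexConj_cxF1_inf_eigenPlus`, `WeilDatum.cxF1_inf_eigenPlus`),
`Θ` carries `V^{1,0}(J_R)` onto `H^{1,0}(Y)` (`map_cxF1_eq_hodgeOneZero`) and commutes with complex
conjugation. [cite: vanGeemen1994HodgeAV, 5.4–5.7] [cite: Deligne1982HodgeCycles, proof of Thm. 4.8, pp. 49–51] -/
theorem cm_projector_of_periodPoint {k : ℕ} {Y : AbelianVariety ℂ} {V : Type} [AddCommGroup V] [Module ℚ V]
    [FiniteDimensional ℚ V] (hY : Y.dim = 2 * k) (hV : Module.finrank ℚ V = 4 * k) (D : Motives.WeilDatum V)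
    {P N : Submodule ℚ V} {R : V →ₗ[ℚ] V} (hRα : ∀ x, R (D.α x) = D.α (R x))
    (hPα : ∀ u ∈ P, D.α u ∈ P) (hNα : ∀ u ∈ N, D.α u ∈ N) (hcpl : IsCompl P N)
    (hJc : ∀ x, ((D.c : ℂ) • D.cxMap R hRα) (((D.c : ℂ) • D.cxMap R hRα) x) = -x)
    (hEP : Module.End.eigenspace ((D.c : ℂ) • D.cxMap R hRα) Complex.I = D.cxSpan hPα)
    (hEN : Module.End.eigenspace ((D.c : ℂ) • D.cxMap R hRα) (-Complex.I) = D.cxSpan hNα)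
    (β : V ≃ₗ[ℚ] bettiCohomology Y.X 1) (Ψ : Y ⟶ Y)
    (hβK : ∀ x, β (D.α x) = bettiCohomology.map Ψ.hom.hom.hom 1 (β x))
    (hβH : ∀ x ∈ HodgeStructure.cxF1 (D.realJ ((D.c : ℂ) • D.cxMap R hRα)),
      IsOfHodgeType (2 * k) Y.X 1 1 0
        (Motives.ofRatClassBaseChange (ComplexPoints Y.X) 1 (β.toLinearMap.baseChange ℂ x))) :
    ∃ Pr : complexBetti Y.X 1 →ₗ[ℂ] complexBetti Y.X 1,
      IsIdempotentElem Pr ∧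
      Pr ∘ₗ (complexBetti.map Ψ.hom.hom.hom 1).hom = (complexBetti.map Ψ.hom.hom.hom 1).hom ∘ₗ Pr ∧
      (∀ x, IsRationalClass x → IsRationalClass (Pr x)) ∧
      LinearMap.range Pr ⊓ Module.End.eigenspace (complexBetti.map Ψ.hom.hom.hom 1).hom D.iSqrt ≤
        hodgeZeroOne (Motives.isSmoothProjective_of_dim_eq' hY) ∧
      LinearMap.ker Pr ⊓ Module.End.eigenspace (complexBetti.map Ψ.hom.hom.hom 1).hom D.iSqrt ≤
        hodgeOneZero (Motives.isSmoothProjective_of_dim_eq' hY) := by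
  have hX := Motives.isSmoothProjective_of_dim_eq' hY
  set Jc : D.Cx →ₗ[ℂ] D.Cx := (D.c : ℂ) • D.cxMap R hRα with hJcdef
  have hJJ := D.realJ_realJ Jc hJc
  -- the comparison `Θ : V_ℂ ≅ H¹(Y(ℂ); ℂ)`
  set Θℓ := Motives.ofRatClassBaseChange (ComplexPoints Y.X) 1 ∘ₗ β.toLinearMap.baseChange ℂ with hΘℓ
  have hinj : Function.Injective Θℓ := by
    refine (ofRatClassBaseChange_injective _ 1).comp fun x y hxy => ?_
    rw [← HodgeStructure.symm_baseChange_baseChange (A := ℂ) β x, hxy,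
      HodgeStructure.symm_baseChange_baseChange]
  have hsurjΘ : Function.Surjective Θℓ := by
    intro y
    obtain ⟨t, rfl⟩ := ofRatClassBaseChange_surjective hX 1 y
    exact ⟨β.symm.toLinearMap.baseChange ℂ t, by
      rw [hΘℓ, LinearMap.comp_apply, HodgeStructure.baseChange_symm_baseChange]⟩
  set Θ : ℂ ⊗[ℚ] V ≃ₗ[ℂ] complexBetti Y.X 1 := LinearEquiv.ofBijective Θℓ ⟨hinj, hsurjΘ⟩ with hΘ
  have hΘx : ∀ x, Θ x = Θℓ x := fun x => rfl
  have hΘtmul : ∀ v : V, Θ ((1 : ℂ) ⊗ₜ v) = ofRatClass (ComplexPoints Y.X) 1 (β v) := by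
    intro v
    rw [hΘx, hΘℓ, LinearMap.comp_apply, LinearMap.baseChange_tmul, Motives.ofRatClassBaseChange_tmul, one_smul]
    rfl
  -- naturality: `Θ ∘ α_ℂ = Ψ^* ∘ Θ`
  set T := (complexBetti.map Ψ.hom.hom.hom 1).hom with hT
  have hK : β.toLinearMap ∘ₗ D.α = (bettiCohomology.map Ψ.hom.hom.hom 1).hom ∘ₗ β.toLinearMap :=
    LinearMap.ext fun x => hβK x
  have hnat : ∀ x, Θ (D.α.baseChange ℂ x) = T (Θ x) := by
    intro x
    rw [hΘx, hΘx, hΘℓ, LinearMap.comp_apply, LinearMap.comp_apply,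
      ← LinearMap.comp_apply (β.toLinearMap.baseChange ℂ), ← LinearMap.baseChange_comp, hK,
      LinearMap.baseChange_comp, LinearMap.comp_apply]
    exact HodgeModel.ofRatClassBaseChange_baseChange_map Ψ.hom.hom.hom 1 _
  -- `Θ` commutes with complex conjugation
  have hΘconj : ∀ t, Θ (HodgeStructure.conj t) = conjClass (ComplexPoints Y.X) 1 (Θ t) := by
    intro t
    induction t using TensorProduct.induction_on with
    | zero => rw [map_zero, map_zero, conjClass_zero]
    | tmul c v =>
      rw [HodgeStructure.conj_tmul]
      have e : ∀ c' : ℂ, (c' ⊗ₜ[ℚ] v : ℂ ⊗[ℚ] V) = c' • ((1 : ℂ) ⊗ₜ v) := fun c' => by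
        rw [TensorProduct.smul_tmul', smul_eq_mul, mul_one]
      rw [e, e c, map_smul, map_smul, hΘtmul, conjClass_smul, conjClass_ofRatClass]
    | add x y hx hy => rw [map_add, map_add, map_add, conjClass_add, hx, hy]
  -- the rational projector and its transport
  set π : V →ₗ[ℚ] V := P.projection N hcpl with hπ
  have hππ : ∀ v, π (π v) = π v := fun v =>
    Submodule.projection_apply_of_mem_left hcpl (Submodule.projection_apply_mem hcpl v)
  have hππ' : π ∘ₗ π = π := LinearMap.ext hππ
  have hπα : π ∘ₗ D.α = D.α ∘ₗ π := by
    refine LinearMap.ext fun v => ?_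
    have hv : v ∈ P ⊔ N := by rw [hcpl.sup_eq_top]; exact Submodule.mem_top
    obtain ⟨vP, hvP, vN, hvN, rfl⟩ := Submodule.mem_sup.1 hv
    rw [LinearMap.comp_apply, LinearMap.comp_apply, map_add, map_add, map_add,
      Submodule.projection_apply_of_mem_left hcpl (hPα _ hvP),
      (Submodule.projection_apply_eq_zero_iff hcpl).2 (hNα _ hvN),
      Submodule.projection_apply_of_mem_left hcpl hvP, (Submodule.projection_apply_eq_zero_iff hcpl).2 hvN,
      add_zero, map_add, map_zero, add_zero]
  set Pr : complexBetti Y.X 1 →ₗ[ℂ] complexBetti Y.X 1 :=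
    Θ.toLinearMap ∘ₗ π.baseChange ℂ ∘ₗ Θ.symm.toLinearMap with hPr
  have hPrx : ∀ y, Pr y = Θ (π.baseChange ℂ (Θ.symm y)) := fun y => rfl
  refine ⟨Pr, ?_, ?_, ?_, ?_, ?_⟩
  · -- idempotent
    refine LinearMap.ext fun y => ?_
    rw [Module.End.mul_apply, hPrx, hPrx, LinearEquiv.symm_apply_apply, ← LinearMap.comp_apply (π.baseChange ℂ),
      ← LinearMap.baseChange_comp, hππ']
  · -- commutes with `Ψ^*`
    refine LinearMap.ext fun y => ?_
    obtain ⟨z, rfl⟩ := Θ.surjective y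
    change Pr (T (Θ z)) = T (Pr (Θ z))
    rw [hPrx, hPrx, LinearEquiv.symm_apply_apply, ← hnat,
      LinearEquiv.symm_apply_apply, ← hnat, ← LinearMap.comp_apply (π.baseChange ℂ), ← LinearMap.baseChange_comp,
      hπα, LinearMap.baseChange_comp, LinearMap.comp_apply]
  · -- defined over `ℚ`
    intro x hx
    obtain ⟨a, rfl⟩ := (isRationalClass_iff_mem_range_ofRatClass x).1 hx
    have hz : Θ.symm (ofRatClass (ComplexPoints Y.X) 1 a) = (1 : ℂ) ⊗ₜ β.symm a := by
      rw [LinearEquiv.symm_apply_eq, hΘtmul, LinearEquiv.apply_symm_apply]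
    rw [hPrx, hz, LinearMap.baseChange_tmul, hΘtmul]
    exact isRationalClass_ofRatClass _
  · -- `im Pr ∩ V₊ ⊆ H^{0,1}`
    intro y hy
    obtain ⟨hyr, hyV⟩ := Submodule.mem_inf.1 hy
    set z := Θ.symm y with hz
    have hyz : y = Θ z := (Θ.apply_symm_apply y).symm
    -- `z ∈ V₊`
    have hzplus : z ∈ D.eigenPlus := by
      change z ∈ Module.End.eigenspace (D.α.baseChange ℂ) D.iSqrt
      rw [Module.End.mem_eigenspace_iff]
      apply Θ.injective
      rw [hnat, map_smul, ← hyz]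
      exact Module.End.mem_eigenspace_iff.1 hyV
    -- `re z ∈ P_ℝ`
    have hzre : HodgeStructure.rePart z ∈ realSpan P := by
      obtain ⟨y', hy'⟩ := LinearMap.mem_range.1 hyr
      have hz' : z = π.baseChange ℂ (Θ.symm y') := by
        rw [hz, ← hy', hPrx, LinearEquiv.symm_apply_apply]
      rw [hz', HodgeStructure.rePart_baseChange]
      change (P.subtype ∘ₗ P.projectionOnto N hcpl).baseChange ℝ _ ∈ _
      rw [LinearMap.baseChange_comp, LinearMap.comp_apply]
      exact LinearMap.mem_range_self _ _
    -- hence `z ∈ conj V^{1,0}(J_R)`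
    have hzlift : z ∈ D.liftPlus (D.cxSpan hPα) :=
      (D.mem_liftPlus_iff).2 ⟨hzplus, (D.mem_cxSpan_iff hPα).2 hzre⟩
    rw [← hEP, ← D.complexConj_cxF1_inf_eigenPlus Jc] at hzlift
    have hzconj : HodgeStructure.conj z ∈ HodgeStructure.cxF1 (D.realJ Jc) :=
      HodgeStructure.mem_complexConj.1 (Submodule.mem_inf.1 hzlift).1
    -- transport: `Θ (conj z) = conj y ∈ H^{1,0}(Y)`, so `y ∈ H^{0,1}(Y)`
    have himage := map_cxF1_eq_hodgeOneZero hY hV (D.realJ Jc) hJJ β hβH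
    have h1 : Θ (HodgeStructure.conj z) ∈ hodgeOneZero hX := by
      rw [← himage]
      exact ⟨_, hzconj, rfl⟩
    rw [hΘconj, ← hyz] at h1
    have h2 := conjClass_mem_hodgeZeroOne hX h1
    rwa [conjClass_conjClass] at h2
  · -- `ker Pr ∩ V₊ ⊆ H^{1,0}`
    intro y hy
    obtain ⟨hyk, hyV⟩ := Submodule.mem_inf.1 hy
    set z := Θ.symm y with hz
    have hyz : y = Θ z := (Θ.apply_symm_apply y).symm
    have hzplus : z ∈ D.eigenPlus := by
      change z ∈ Module.End.eigenspace (D.α.baseChange ℂ) D.iSqrt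
      rw [Module.End.mem_eigenspace_iff]
      apply Θ.injective
      rw [hnat, map_smul, ← hyz]
      exact Module.End.mem_eigenspace_iff.1 hyV
    -- `π_ℂ z = 0`, so `z = π^N_ℂ z` and `re z ∈ N_ℝ`
    have hπz : π.baseChange ℂ z = 0 := by
      apply Θ.injective
      rw [map_zero, ← hPrx]
      exact LinearMap.mem_ker.1 hyk
    have hzre : HodgeStructure.rePart z ∈ realSpan N := by
      have hz' : z = (N.projection P hcpl.symm).baseChange ℂ z := by
        rw [Submodule.projection_eq_id_sub_projection hcpl, LinearMap.baseChange_sub, LinearMap.sub_apply,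
          LinearMap.baseChange_id, LinearMap.id_apply]
        change z = z - π.baseChange ℂ z
        rw [hπz, sub_zero]
      rw [hz', HodgeStructure.rePart_baseChange]
      change (N.subtype ∘ₗ N.projectionOnto P hcpl.symm).baseChange ℝ _ ∈ _
      rw [LinearMap.baseChange_comp, LinearMap.comp_apply]
      exact LinearMap.mem_range_self _ _
    have hzlift : z ∈ D.liftPlus (D.cxSpan hNα) :=
      (D.mem_liftPlus_iff).2 ⟨hzplus, (D.mem_cxSpan_iff hNα).2 hzre⟩
    rw [← hEN, ← D.cxF1_inf_eigenPlus Jc] at hzlift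
    have hzF : z ∈ HodgeStructure.cxF1 (D.realJ Jc) := (Submodule.mem_inf.1 hzlift).1
    have himage := map_cxF1_eq_hodgeOneZero hY hV (D.realJ Jc) hJJ β hβH
    rw [hyz, hΘx, ← himage]
    exact ⟨z, hzF, rfl⟩


/-- **The CM projector of the fibre over the rational diagonal point** — `cm_projector_of_periodPoint`
with every binder displayed (the registered sub-goal of line `Sketch` for this file).
[cite: vanGeemen1994HodgeAV, 5.4–5.7] [cite: Deligne1982HodgeCycles, proof of Thm. 4.8, pp. 49–51] -/
theorem cm_projector_exists :
    ∀ (k : ℕ) (Y : AbelianVariety ℂ) (V : Type) [AddCommGroup V] [Module ℚ V] [FiniteDimensional ℚ V] (hY : Y.dim = 2 * k), Module.finrank ℚ V = 4 * k → ∀ (D : Motives.WeilDatum V) (P N : Submodule ℚ V) (R : V →ₗ[ℚ] V) (hRα : ∀ x, R (D.α x) = D.α (R x)) (hPα : ∀ u ∈ P, D.α u ∈ P) (hNα : ∀ u ∈ N, D.α u ∈ N), IsCompl P N → (∀ x, ((D.c : ℂ) • D.cxMap R hRα) (((D.c : ℂ) • D.cxMap R hRα) x) = -x) → Module.End.eigenspace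 ((D.c : ℂ) • D.cxMap R hRα) Complex.I = D.cxSpan hPα → Module.End.eigenspace ((D.c : ℂ) • D.cxMap R hRα) (-Complex.I) = D.cxSpan hNα → ∀ (β : V ≃ₗ[ℚ] bettiCohomology Y.X 1) (Ψ : Y ⟶ Y), (∀ x, β (D.α x) = bettiCohomology.map Ψ.hom.hom.hom 1 (β x)) → (∀ x ∈ HodgeStructure.cxF1 (D.realJ ((D.c : ℂ) • D.cxMap R hRα)), IsOfHodgeType (2 * k) Y.X 1 1 0 (Motives.ofRatClassBaseChange (ComplexPoints Y.X) 1 (β.toLinearMap.baseChange ℂ x))) → ∃ Pr : complexBetti Y.X 1 →ₗ[ℂ] complexBetti Y.X 1, IsIdempotentElem Pr ∧ Pr ∘ₗ (complexBetti.map Ψ.hom.hom.hom 1).hom = (complexBetti.map Ψ.hom.hom.hom 1).hom ∘ₗ Pr ∧ (∀ x, IsRationalClass x → IsRationalClass (Pr x)) ∧ LinearMap.range Pr ⊓ Module.End.eigenspace (complexBetti.map Ψ.hom.hom.hom 1).hom D.iSqrt ≤ hodgeZeroOne (Motives.isSmoothProjective_of_dim_eq' hY) ∧ LinearMap.ker Pr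 ⊓ Module.End.eigenspace (complexBetti.map Ψ.hom.hom.hom 1).hom D.iSqrt ≤ hodgeOneZero (Motives.isSmoothProjective_of_dim_eq' hY) :=
  fun _ _ _ _ _ _ hY hV D _ _ _ hRα hPα hNα hcpl hJc hEP hEN β Ψ hβK hβH =>
    cm_projector_of_periodPoint hY hV D hRα hPα hNα hcpl hJc hEP hEN β Ψ hβK hβH

end Summit.HodgeConjecture.HodgeConjecture.Theorems.HeckePrymWeilLine

end
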